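import Mathlib
import Summits.Ventures.PercRepro2.Defs
import Summits.Ventures.PercRepro2.Graph
import Summits.Ventures.PercRepro2.OneColourSwitch
import Summits.Ventures.PercRepro2.RegionHubSign
import Summits.Ventures.PercRepro2.SideSwitch
import Summits.Ventures.PercRepro2.SideSwitchM9
import Summits.Ventures.PercRepro2.SideSwitchClosed
import Summits.Ventures.PercRepro2.SideSwitchComps
import Summits.Ventures.PercRepro2.SideSwitchFibre
import Summits.Ventures.PercRepro2.TermSwitchDefs
import Summits.Ventures.PercRepro2.TermSwitchFibre
import Summits.Ventures.PercRepro2.TermSwitchCompsFibre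
import Summits.Ventures.PercRepro2.TermSwitchMono
import Summits.Ventures.PercRepro2.TermSwitchM9
import Summits.Ventures.PercRepro2.TermSwitchReach
import Summits.Ventures.PercRepro2.TermSwitchRestrict
import Summits.Ventures.PercRepro2.M9NoPocketDefs
import Summits.Ventures.PercRepro2.M9GeneralDSplit
import Summits.Ventures.PercRepro2.M9ReachedSum
import Summits.Ventures.PercRepro2.M9FourParts
import Summits.Ventures.PercRepro2.M9CornerHarris
import Summits.Ventures.PercRepro2.M9OneSidedFibre
import Summits.Ventures.PercRepro2.M9OneSidedFibreM
import Summits.Ventures.PercRepro2.M9OneSidedCorner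

/-!
# THEOREM ⟦Lz⟧ in the `T`-free class: the clean one-sided reached part is non-positive when `d`
is adjacent to neither `r` nor `s` (blind cell PercRepro2, p3 g30, 2026-08-28;
`proofs/P3-HDR.md` §10(c))

`cleanReachedSum = Σ_{Sep_H ∧ DZero_H ∧ d one-sided} σ_pq σ_rs` (`H = {r, s, d}`) is the
restricted three-terminal sum with the predicate «`d` in exactly one world» — NOT fibre-invariant,
so `dzeroSignSumHP_nonpos` does not apply; instead, per representative the one-sided points are
the corner pair of the joining blocks (`M9OneSidedCorner`), the outside flip preserves the
predicate (`oneSided_assignC_flipOH_iff`), and the corner-pair Harris step closes the paired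
sum (`corner_fibre_sum_nonpos`).  Hence **`cleanReachedSum ≤ 0`** (`cleanReachedSum_nonpos_of_tfree`)
and, with `M9FourParts`, the single-`d` statement in the `T`-free class follows from
`EX + HD ≤ 0` alone (`dSignSum_nonpos_of_exhd_tfree`).  Own work; std axioms.
-/

namespace Summit.Ventures.PercRepro2

namespace TermSwitch

open Finset Classical RegionHub OneColourSwitch SideSwitch

variable {V : Type*} {E : Type*}

section TFreeLz

variable [Fintype V] [DecidableEq V] [Fintype E] [DecidableEq E] {ends : E → Sym2 V}
  {p q r s d : V}

omit [Fintype E] [DecidableEq E] in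
/-- The component assignment of the outside-flipped representative is the outside flip of the
component assignment. -/
lemma assignC_flipOH_eq {ρ : Config E} {T : Finset (Finset V)}
    (hT : T ⊆ compsH ends ({r, s, d} : Set V) ρ) :
    assignC ends T (flipOH ends ({r, s, d} : Set V) ρ) =
      flipIn ends (OsetH ends ({r, s, d} : Set V) (assignC ends T ρ)) (assignC ends T ρ) := by
  rw [OsetH_assignC hT]
  simp only [flipOH, assignC, assign]
  exact (flipIn_flipTouch _ _ _).symm

omit [Fintype E] [DecidableEq E] in
/-- **One-sidedness is invariant under the outside flip** of the three-terminal fibration. -/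
lemma oneSided_assignC_flipOH_iff {ρ : Config E} {T : Finset (Finset V)}
    (hT : T ⊆ compsH ends ({r, s, d} : Set V) ρ) :
    NoPocket.OneSided ends r s d (assignC ends T (flipOH ends ({r, s, d} : Set V) ρ)) ↔
      NoPocket.OneSided ends r s d (assignC ends T ρ) := by
  rw [assignC_flipOH_eq hT]
  simp only [NoPocket.OneSided, K2_flipIn_OsetH (r_mem_triple r s d) (s_mem_triple r s d),
    M2_flipIn_OsetH (r_mem_triple r s d) (s_mem_triple r s d)]

omit [Fintype V] [DecidableEq V] in
/-- The clean one-sided reached sum is the restricted three-terminal sum with the one-sided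
predicate. -/
lemma cleanReachedSum_eq_dzeroSignSumHP :
    NoPocket.cleanReachedSum ends p q r s d =
      dzeroSignSumHP ends p q r s ({r, s, d} : Set V) (NoPocket.OneSided ends r s d) := by
  unfold NoPocket.cleanReachedSum dzeroSignSumHP
  refine Finset.sum_congr rfl fun ω _ => ?_
  by_cases h : sepH ends p q ({r, s, d} : Set V) ω ∧ DZeroH ends ({r, s, d} : Set V) ω
  · have hsep := NoPocket.sep2_of_sepH_triple h.1
    have hD := NoPocket.DOne_of_DZeroH_triple h.2
    by_cases hone : NoPocket.OneSided ends r s d ω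
    · rw [if_pos ⟨hsep, hD, hone, h⟩, if_pos ⟨h.1, h.2, hone⟩]
    · rw [if_neg (fun h' => hone h'.2.2.1), if_neg (fun h' => hone h'.2.2)]
  · rw [if_neg (fun h' => h h'.2.2.2), if_neg (fun h' => h ⟨h'.1, h'.2.1⟩)]

/-- **THEOREM ⟦Lz⟧, `T`-free**: the clean one-sided reached part of the single-`d` sum is
non-positive when `d` is adjacent to neither `r` nor `s` (and there is no `r–s` edge). -/
theorem cleanReachedSum_nonpos_of_tfree (hT : TFree ends r s d) :
    NoPocket.cleanReachedSum ends p q r s d ≤ 0 := by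
  rw [cleanReachedSum_eq_dzeroSignSumHP]
  have hr : r ∈ ({r, s, d} : Set V) := r_mem_triple r s d
  -- the fibration
  have hsum : dzeroSignSumHP ends p q r s ({r, s, d} : Set V) (NoPocket.OneSided ends r s d) =
      ∑ ρ ∈ RepH ends p q ({r, s, d} : Set V), ∑ T ∈ (compsH ends ({r, s, d} : Set V) ρ).powerset,
        (if NoPocket.OneSided ends r s d (assignC ends T ρ) then sigma ends (assignC ends T ρ) p q *
          sigma ends (assignC ends T ρ) r s else 0) := by
    have h1 : dzeroSignSumHP ends p q r s ({r, s, d} : Set V) (NoPocket.OneSided ends r s d) =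
        ∑ ω ∈ DZeroSetH ends p q ({r, s, d} : Set V), if NoPocket.OneSided ends r s d ω then sigma ends ω p q * sigma ends ω r s else 0 := by
      have hset : DZeroSetH ends p q ({r, s, d} : Set V) =
          univ.filter (fun ω => sepH ends p q ({r, s, d} : Set V) ω ∧ DZeroH ends ({r, s, d} : Set V) ω) := by
        ext ω; simp [DZeroSetH, SepSetH]
      rw [hset, Finset.sum_filter, dzeroSignSumHP]
      refine Finset.sum_congr rfl (fun ω _ => ?_)
      by_cases h1 : sepH ends p q ({r, s, d} : Set V) ω ∧ DZeroH ends ({r, s, d} : Set V) ω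
      · by_cases h2 : NoPocket.OneSided ends r s d ω
        · rw [if_pos ⟨h1.1, h1.2, h2⟩, if_pos h1, if_pos h2]
        · rw [if_neg (fun h => h2 h.2.2), if_pos h1, if_neg h2]
      · rw [if_neg (fun h => h1 ⟨h.1, h.2.1⟩), if_neg h1]
    rw [h1, sum_dzeroH_eq_sum_repH_comps (fun ω => if NoPocket.OneSided ends r s d ω then sigma ends ω p q *
      sigma ends ω r s else 0)]
  -- the outside flip
  have hsumO : (∑ ρ ∈ RepH ends p q ({r, s, d} : Set V), ∑ T ∈ (compsH ends ({r, s, d} : Set V) ρ).powerset,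
        (if NoPocket.OneSided ends r s d (assignC ends T ρ) then sigma ends (assignC ends T ρ) p q *
          sigma ends (assignC ends T ρ) r s else 0)) =
      ∑ ρ ∈ RepH ends p q ({r, s, d} : Set V), ∑ T ∈ (compsH ends ({r, s, d} : Set V) ρ).powerset,
        (if NoPocket.OneSided ends r s d (assignC ends T ρ) then sigma ends (assignC ends T (flipOH ends ({r, s, d} : Set V) ρ)) p q *
          sigma ends (assignC ends T ρ) r s else 0) := by
    symm
    refine Finset.sum_nbij' (fun ρ => flipOH ends ({r, s, d} : Set V) ρ) (fun ρ => flipOH ends ({r, s, d} : Set V) ρ)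
      (fun ρ hρ => flipOH_mem_RepH hρ) (fun ρ hρ => flipOH_mem_RepH hρ)
      (fun ρ _ => flipOH_flipOH ({r, s, d} : Set V) ρ) (fun ρ _ => flipOH_flipOH ({r, s, d} : Set V) ρ) ?_
    intro ρ _
    rw [compsH_flipOH]
    refine Finset.sum_congr rfl (fun T hT' => ?_)
    have hTc : T ⊆ compsH ends ({r, s, d} : Set V) ρ := Finset.mem_powerset.1 hT'
    rw [oneSided_assignC_flipOH_iff hTc, sigma_rs_assignC_flipOH hr s hTc]
  -- the per-representative corner sum
  have hkey : ∀ ρ ∈ RepH ends p q ({r, s, d} : Set V),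
      (∑ T ∈ (compsH ends ({r, s, d} : Set V) ρ).powerset,
        (if NoPocket.OneSided ends r s d (assignC ends T ρ) then
          (sigma ends (assignC ends T ρ) p q + sigma ends (assignC ends T (flipOH ends ({r, s, d} : Set V) ρ)) p q) *
            sigma ends (assignC ends T ρ) r s else 0)) ≤ 0 := by
    intro ρ hρ
    have hρM : ∀ x ∈ MH ends ({r, s, d} : Set V) ρ, x ∈ ({r, s, d} : Set V) := (mem_RepH.1 hρ).2
    by_cases hJ : (joinSet ends r s d ρ).Nonempty
    · have hJA : joinSet ends r s d ρ ⊆ compsH ends ({r, s, d} : Set V) ρ := Finset.filter_subset _ _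
      have heq : (∑ T ∈ (compsH ends ({r, s, d} : Set V) ρ).powerset,
          (if NoPocket.OneSided ends r s d (assignC ends T ρ) then
            (sigma ends (assignC ends T ρ) p q +
              sigma ends (assignC ends T (flipOH ends ({r, s, d} : Set V) ρ)) p q) *
              sigma ends (assignC ends T ρ) r s else 0)) =
          ∑ T ∈ corners (compsH ends ({r, s, d} : Set V) ρ) (joinSet ends r s d ρ),
            (sigma ends (assignC ends T ρ) p q +
              sigma ends (assignC ends T (flipOH ends ({r, s, d} : Set V) ρ)) p q) *
              sigma ends (assignC ends T ρ) r s := by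
        rw [← Finset.sum_filter]
        refine Finset.sum_congr ?_ (fun _ _ => rfl)
        ext T
        simp only [Finset.mem_filter, corners, Finset.mem_powerset]
        constructor
        · rintro ⟨hTc, hone⟩
          exact ⟨hTc, (Finset.mem_filter.1 ((oneSided_assignC_iff_corners hT hρM hTc).1 hone).2).2⟩
        · rintro ⟨hTc, hc⟩
          exact ⟨hTc, (oneSided_assignC_iff_corners hT hρM hTc).2
            ⟨hJ, Finset.mem_filter.2 ⟨Finset.mem_powerset.2 hTc, hc⟩⟩⟩
      rw [heq]
      exact corner_fibre_sum_nonpos hρ hr s hJA hJ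
    · refine le_of_eq (Finset.sum_eq_zero (fun T hT' => ?_))
      have hTc : T ⊆ compsH ends ({r, s, d} : Set V) ρ := Finset.mem_powerset.1 hT'
      rw [if_neg (fun h => hJ ((oneSided_assignC_iff_corners hT hρM hTc).1 h).1)]
  have htwice : 2 * dzeroSignSumHP ends p q r s ({r, s, d} : Set V) (NoPocket.OneSided ends r s d) ≤ 0 := by
    calc 2 * dzeroSignSumHP ends p q r s ({r, s, d} : Set V) (NoPocket.OneSided ends r s d)
        = dzeroSignSumHP ends p q r s ({r, s, d} : Set V) (NoPocket.OneSided ends r s d) + dzeroSignSumHP ends p q r s ({r, s, d} : Set V) (NoPocket.OneSided ends r s d) := by ring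
      _ = (∑ ρ ∈ RepH ends p q ({r, s, d} : Set V), ∑ T ∈ (compsH ends ({r, s, d} : Set V) ρ).powerset,
            (if NoPocket.OneSided ends r s d (assignC ends T ρ) then sigma ends (assignC ends T ρ) p q *
              sigma ends (assignC ends T ρ) r s else 0)) +
          ∑ ρ ∈ RepH ends p q ({r, s, d} : Set V), ∑ T ∈ (compsH ends ({r, s, d} : Set V) ρ).powerset,
            (if NoPocket.OneSided ends r s d (assignC ends T ρ) then sigma ends (assignC ends T (flipOH ends ({r, s, d} : Set V) ρ)) p q *
              sigma ends (assignC ends T ρ) r s else 0) := by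
          rw [← hsumO, ← hsum]
      _ = ∑ ρ ∈ RepH ends p q ({r, s, d} : Set V), ∑ T ∈ (compsH ends ({r, s, d} : Set V) ρ).powerset,
            (if NoPocket.OneSided ends r s d (assignC ends T ρ) then
              (sigma ends (assignC ends T ρ) p q +
                sigma ends (assignC ends T (flipOH ends ({r, s, d} : Set V) ρ)) p q) *
                sigma ends (assignC ends T ρ) r s else 0) := by
          rw [← Finset.sum_add_distrib]
          refine Finset.sum_congr rfl (fun ρ _ => ?_)
          rw [← Finset.sum_add_distrib]
          refine Finset.sum_congr rfl (fun T _ => ?_)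
          by_cases hP' : NoPocket.OneSided ends r s d (assignC ends T ρ)
          · simp only [if_pos hP']
            ring
          · simp only [if_neg hP', add_zero]
      _ ≤ 0 := Finset.sum_nonpos (fun ρ hρ => hkey ρ hρ)
  linarith

/-- **The single-`d` statement in the `T`-free class from `EX + HD ≤ 0` alone.** -/
theorem dSignSum_nonpos_of_exhd_tfree (hT : TFree ends r s d)
    (h : NoPocket.exSum ends p q r s d + NoPocket.hdSum ends p q r s d ≤ 0) :
    NoPocket.dSignSum ends p q r s d ≤ 0 :=
  NoPocket.dSignSum_nonpos_of_exhd_lz h (cleanReachedSum_nonpos_of_tfree hT)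

end TFreeLz

end TermSwitch

end Summit.Ventures.PercRepro2
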